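import Mathlib
import Literature.NumberTheory.LFunctions.Zhang2022.Section5Lemma53
import Literature.NumberTheory.LFunctions.Zhang2022.Section2SmoothWeight
import HarnessLib

/-!
# Zhang (2022) §5/§7: `Δ(x)` is negligible away from `t₀` — `|Δ(x)| ≤ e^{−c𝓛¹⁰}x⁻⁶` for `|x − t₀| ≥ (3/5)t₀`

Topic `Literature/NumberTheory/LFunctions/Zhang2022` (Landau–Siegel audit tree; verdict-neutral).
Y. Zhang, *Discrete mean estimates and the Landau–Siegel zero*, arXiv:2211.02515v1 (2022)
[Zhang2022LandauSiegel] — **an unrefereed manuscript under adjudication; nothing here asserts or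
denies its Theorems 1–2.** Campaign D-0069 (seat sz-d26), infrastructure for the `Δ`-localisation
steps of §7 ("By Lemma 5.1 [5.3], the terms with `l ∉ 𝔌(Rh)` in `𝔰(r,h,d;θ)` make a negligible
contribution", Z22:§7.u037, tex L2036) and its §14/§15 analogues.

From the DISCHARGED node Lemma 5.3 (`Skeleton.lemma53_holds`, sz-d03): (5.8) `Δ(x) = ω(1/2+2πix)
(1+O(α)) + O(e^{−c𝓛¹⁰})` for `x ≤ t₀^{1.02}` and (5.9) `Δ(x) ≪ exp{−(10⁻²𝓛₂log x)²} +
exp{−x^{0.99}/𝓛₂}` for `x > t₀^{1.02}`, together with the Gaussian profile `|ω(1/2+2πix)| =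
(√π/𝓛₂)exp{−(π(x−t₀)/𝓛₂)²}` (`SmoothWeight.omega_half_eq`), we derive ONE bound valid on both
ranges, with polynomial decay in `x` (so that it can be summed over `l` against divisor-type
coefficients) and the saving `e^{−c𝓛¹⁰}`:

* `norm_DeltaW_le_of_far` — `∃ c > 0`, for all large `D`: for every `x > 0` with
  `|x − t₀| ≥ (3/5)t₀`, `‖Δ(x)‖ ≤ e^{−c𝓛¹⁰}·x⁻⁶`.

## References

* Y. Zhang, arXiv:2211.02515v1 (2022), §5 Lemma 5.3 (5.8)–(5.9) p.25, Note before Lemma 5.3;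
  §7 p.38 (tex L2036). [cite: Zhang2022LandauSiegel, §5 Lemma 5.3; §7 p.38]
-/

noncomputable section

open Complex Real Filter Topology

namespace Literature.NumberTheory.LFunctions.Zhang2022.DeltaFar

open Skeleton

/-- `𝓛 = log D → ∞`. [folklore] -/
private theorem tendsto_ell : Tendsto (fun D : ℕ => ell D) atTop atTop :=
  Real.tendsto_log_atTop.comp tendsto_natCast_atTop_atTop

/-- An eventual property of `𝓛` holds for all large `D`. [folklore] -/
private theorem eventually_ell {p : ℝ → Prop} (h : ∀ᶠ L in atTop, p L) :
    ∃ D₀ : ℕ, ∀ D : ℕ, D₀ ≤ D → p (ell D) :=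
  Filter.eventually_atTop.mp (tendsto_ell.eventually h)

/-- `e^{−y} ≤ 7!·2⁷/y⁷` for `y > 0` (from `(y/2)⁷/7! ≤ e^{y/2}`), keeping a factor `e^{−y/2}`:
`e^{−y} ≤ (645120/y⁷)·e^{−y/2}`. [folklore] -/
private theorem exp_neg_le_div_pow_mul {y : ℝ} (hy : 0 < y) :
    Real.exp (-y) ≤ 645120 / y ^ 7 * Real.exp (-(y / 2)) := by
  have h := Real.pow_div_factorial_le_exp (y / 2) (by linarith) 7
  have h7 : ((Nat.factorial 7 : ℕ) : ℝ) = 5040 := by norm_num [Nat.factorial]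
  rw [h7] at h
  have hy7 : 0 < y ^ 7 := by positivity
  have e1 : Real.exp (-y) = Real.exp (-(y / 2)) * Real.exp (-(y / 2)) := by
    rw [← Real.exp_add]; ring_nf
  rw [e1]
  refine mul_le_mul_of_nonneg_right ?_ (Real.exp_pos _).le
  -- `e^{−y/2} ≤ 5040/(y/2)⁷ = 645120/y⁷`
  have hpos : 0 < Real.exp (y / 2) := Real.exp_pos _
  have h2 : (y / 2) ^ 7 = y ^ 7 / 128 := by ring
  rw [h2] at h
  -- `h : y^7/128/5040 ≤ e^{y/2}`, i.e. `y^7 ≤ 645120 e^{y/2}`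
  have h3 : y ^ 7 ≤ 645120 * Real.exp (y / 2) := by
    have := h; rw [div_div, div_le_iff₀ (by norm_num : (0:ℝ) < 128 * 5040)] at this; linarith
  rw [Real.exp_neg, inv_le_iff_one_le_mul₀ hpos, div_mul_eq_mul_div, one_le_div hy7]
  linarith

/-! ### Parameter facts (`𝓛 ≥ 10⁴`) -/

section Params

variable {D : ℕ}

/-- Sizes of the parameters once `𝓛 ≥ 10⁴`: `𝓛, t₀ = 𝓛⁵¹⁹, 𝓛₂ = 𝓛⁴⁰⁰ ≥ 1`. [folklore] -/
private theorem ell_facts (hℓ : (10000 : ℝ) ≤ ell D) :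
    1 ≤ ell D ∧ 0 < ell D ∧ 1 ≤ t0 D ∧ 0 < t0 D ∧ 1 ≤ ell2 D ∧ 0 < ell2 D ∧
      t0 D = ell D ^ 519 ∧ ell2 D = ell D ^ 400 := by
  have hℓ1 : 1 ≤ ell D := by linarith
  have ht01 : 1 ≤ t0 D := one_le_pow₀ hℓ1
  have hℓ21 : 1 ≤ ell2 D := one_le_pow₀ hℓ1
  exact ⟨hℓ1, by linarith, ht01, by linarith, hℓ21, by linarith, rfl, rfl⟩

/-- First term of (5.9): `exp{−(10⁻²𝓛₂ log x)²} ≤ e^{−𝓛¹⁰}x⁻⁶` once `log x ≥ 1` (`𝓛 ≥ 10⁴`).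
[cite: Zhang2022LandauSiegel, §5 Lemma 5.3 (5.9)] -/
private theorem exp_logsq_le (hℓ : (10000 : ℝ) ≤ ell D) {x : ℝ} (hx : 0 < x)
    (hu1 : 1 ≤ Real.log x) :
    Real.exp (-((1 : ℝ) / 100 * ell2 D * Real.log x) ^ 2) ≤ Real.exp (-ell D ^ 10) * (x ^ 6)⁻¹ := by
  obtain ⟨hℓ1, hℓ0, -, -, -, -, -, hℓ2⟩ := ell_facts hℓ
  set u : ℝ := Real.log x with hu
  have hxu : Real.exp u = x := by rw [hu, Real.exp_log hx]
  have hx6u : Real.exp (-(6 * u)) = (x ^ 6)⁻¹ := by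
    rw [Real.exp_neg, show 6 * u = ((6 : ℕ) : ℝ) * u by norm_num, Real.exp_nat_mul, hxu]
  rw [← hx6u, ← Real.exp_add]
  apply Real.exp_le_exp.mpr
  have h7 : 7 * ell D ^ 10 ≤ ell D ^ 799 := by
    calc 7 * ell D ^ 10 ≤ ell D ^ 789 * ell D ^ 10 := by
          apply mul_le_mul_of_nonneg_right _ (pow_nonneg hℓ0.le 10)
          calc (7 : ℝ) ≤ ell D := by linarith
            _ ≤ ell D ^ 789 := le_self_pow₀ hℓ1 (by norm_num)
      _ = ell D ^ 799 := by rw [← pow_add]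
  have hsq : ((1 : ℝ) / 100 * ell2 D * u) ^ 2 = ell D * ell D ^ 799 * u ^ 2 / 10000 := by
    rw [hℓ2]; ring
  rw [hsq]
  have hu2 : u ≤ u ^ 2 := by nlinarith
  have hℓ10 : 1 ≤ ell D ^ 10 := one_le_pow₀ hℓ1
  have h799u : 0 ≤ ell D ^ 799 * u := mul_nonneg (pow_nonneg hℓ0.le 799) (by linarith)
  have key : 10000 * (6 * u + ell D ^ 10) ≤ ell D * ell D ^ 799 * u ^ 2 := by
    calc 10000 * (6 * u + ell D ^ 10) ≤ 10000 * (7 * ell D ^ 10 * u) := by nlinarith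
      _ ≤ 10000 * (ell D ^ 799 * u) := by nlinarith
      _ ≤ ell D * (ell D ^ 799 * u ^ 2) := by
          apply mul_le_mul hℓ _ h799u hℓ0.le
          nlinarith [pow_nonneg hℓ0.le 799]
      _ = ell D * ell D ^ 799 * u ^ 2 := by ring
  have key' : 6 * u + ell D ^ 10 ≤ ell D * ell D ^ 799 * u ^ 2 / 10000 := by
    rw [le_div_iff₀ (by norm_num : (0:ℝ) < 10000)]; linarith
  linarith

/-- Second term of (5.9): `exp{−x^{0.99}/𝓛₂} ≤ 7!2⁷𝓛₂⁷x⁻⁶e^{−𝓛¹⁰}` once `x ≥ 1` and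
`x^{0.99} ≥ 2𝓛¹⁰𝓛₂`. [cite: Zhang2022LandauSiegel, §5 Lemma 5.3 (5.9)] -/
private theorem exp_rpow_le (hℓ : (10000 : ℝ) ≤ ell D) {x : ℝ} (hx1 : 1 ≤ x)
    (hbig : ell D ^ 10 * 2 * ell2 D ≤ x ^ (0.99 : ℝ)) :
    Real.exp (-(x ^ (0.99 : ℝ)) / ell2 D) ≤
      645120 * ell2 D ^ 7 * (x ^ 6)⁻¹ * Real.exp (-ell D ^ 10) := by
  obtain ⟨-, -, -, -, -, hℓ2pos, -, -⟩ := ell_facts hℓ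
  have hx : 0 < x := by linarith
  have hx6 : 0 < x ^ 6 := by positivity
  set y : ℝ := x ^ (0.99 : ℝ) / ell2 D with hy
  have hx099 : 0 < x ^ (0.99 : ℝ) := Real.rpow_pos_of_pos hx _
  have hy0 : 0 < y := div_pos hx099 hℓ2pos
  have hy7pos : 0 < y ^ 7 := pow_pos hy0 7
  have hcoef : (0 : ℝ) ≤ 645120 * ell2 D ^ 7 * (x ^ 6)⁻¹ :=
    mul_nonneg (mul_nonneg (by norm_num) (pow_nonneg hℓ2pos.le 7)) (inv_nonneg.mpr hx6.le)
  have e0 : -(x ^ (0.99 : ℝ)) / ell2 D = -y := by rw [hy, neg_div]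
  rw [e0]
  have h1 := exp_neg_le_div_pow_mul hy0
  have hy7 : x ^ 6 / ell2 D ^ 7 ≤ y ^ 7 := by
    rw [hy, div_pow, ← Real.rpow_natCast (x ^ (0.99 : ℝ)) 7, ← Real.rpow_mul hx.le]
    apply div_le_div_of_nonneg_right _ (pow_nonneg hℓ2pos.le 7)
    rw [show (x ^ 6 : ℝ) = x ^ ((6 : ℕ) : ℝ) from (Real.rpow_natCast x 6).symm]
    exact Real.rpow_le_rpow_of_exponent_le hx1 (by norm_num)
  have hdiv : 645120 / y ^ 7 ≤ 645120 * ell2 D ^ 7 * (x ^ 6)⁻¹ := by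
    rw [div_le_iff₀ hy7pos]
    calc (645120 : ℝ) = 645120 * ell2 D ^ 7 * (x ^ 6)⁻¹ * (x ^ 6 / ell2 D ^ 7) := by
          field_simp
      _ ≤ 645120 * ell2 D ^ 7 * (x ^ 6)⁻¹ * y ^ 7 := mul_le_mul_of_nonneg_left hy7 hcoef
  have hy2 : Real.exp (-(y / 2)) ≤ Real.exp (-ell D ^ 10) := by
    apply Real.exp_le_exp.mpr
    rw [neg_le_neg_iff, le_div_iff₀ (by norm_num : (0:ℝ) < 2), hy, le_div_iff₀ hℓ2pos]
    exact hbig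
  calc Real.exp (-y) ≤ 645120 / y ^ 7 * Real.exp (-(y / 2)) := h1
    _ ≤ 645120 * ell2 D ^ 7 * (x ^ 6)⁻¹ * Real.exp (-ell D ^ 10) :=
        mul_le_mul hdiv hy2 (Real.exp_pos _).le hcoef

/-- (5.8) range: `‖Δ(x)‖ ≤ (2C₀π + 3)e^{−min(c,1)𝓛¹⁰}` from the (5.8) inequality when
`|x − t₀| ≥ (3/5)t₀` (the Gaussian `|ω(1/2+2πix)| ≤ 2e^{−𝓛¹⁰}`).
[cite: Zhang2022LandauSiegel, §5 Lemma 5.3 (5.8)] -/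
private theorem near_range (hℓ : (10000 : ℝ) ≤ ell D) {x C c : ℝ}
    (hfar : 3 / 5 * t0 D ≤ |x - t0 D|)
    (h58 : ‖DeltaW D x - omegaW D (1 / 2 + 2 * π * x * I)‖ ≤
      C * alpha D * ‖omegaW D (1 / 2 + 2 * π * x * I)‖ + Real.exp (-c * ell D ^ 10)) :
    ‖DeltaW D x‖ ≤ (2 * max C 0 * π + 3) * Real.exp (-min c 1 * ell D ^ 10) := by
  obtain ⟨hℓ1, hℓ0, -, ht0pos, hℓ21, hℓ2pos, ht0, hℓ2⟩ := ell_facts hℓ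
  set c₁ : ℝ := min c 1
  set C₀ : ℝ := max C 0
  have hC₀0 : 0 ≤ C₀ := le_max_right _ _
  have hCC₀ : C ≤ C₀ := le_max_left _ _
  have hexp1 : Real.exp (-ell D ^ 10) ≤ Real.exp (-c₁ * ell D ^ 10) := by
    apply Real.exp_le_exp.mpr
    have : 0 ≤ ell D ^ 10 := pow_nonneg hℓ0.le 10
    nlinarith [min_le_right c 1]
  have hexpc : Real.exp (-c * ell D ^ 10) ≤ Real.exp (-c₁ * ell D ^ 10) := by
    apply Real.exp_le_exp.mpr
    have : 0 ≤ ell D ^ 10 := pow_nonneg hℓ0.le 10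
    nlinarith [min_le_left c 1]
  -- the Gaussian factor
  have hω : ‖omegaW D (1 / 2 + 2 * π * x * I)‖ ≤ 2 * Real.exp (-ell D ^ 10) := by
    have e1 : omegaW D (1 / 2 + 2 * π * x * I) =
        (SmoothWeight.omegaLine (ell2 D) (t0 D) x : ℂ) :=
      SmoothWeight.omega_half_eq hℓ2pos.ne' (t0 D) x
    rw [e1, Complex.norm_real, Real.norm_of_nonneg (SmoothWeight.omegaLine_nonneg hℓ2pos _ _),
      SmoothWeight.omegaLine_def]
    have hsq : Real.sqrt π / ell2 D ≤ 2 := by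
      rw [div_le_iff₀ hℓ2pos]
      have h4 : Real.sqrt π ≤ 2 := by
        have := Real.sqrt_le_sqrt Real.pi_lt_four.le
        rwa [show Real.sqrt 4 = 2 by
          rw [show (4 : ℝ) = 2 ^ 2 by norm_num, Real.sqrt_sq (by norm_num : (0:ℝ) ≤ 2)]] at this
      linarith
    have hgauss : Real.exp (-(π * (x - t0 D) / ell2 D) ^ 2) ≤ Real.exp (-ell D ^ 10) := by
      apply Real.exp_le_exp.mpr
      rw [neg_le_neg_iff]
      have hπ2 : (9 : ℝ) ≤ π ^ 2 := by nlinarith [Real.pi_gt_three]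
      have h35 : (0 : ℝ) ≤ 3 / 5 * t0 D := by linarith
      have hsqd : (3 / 5 * t0 D) ^ 2 ≤ (x - t0 D) ^ 2 := by
        calc (3 / 5 * t0 D) ^ 2 ≤ |x - t0 D| ^ 2 := pow_le_pow_left₀ h35 hfar 2
          _ = (x - t0 D) ^ 2 := sq_abs _
      have h2 : ell D ^ 10 * ell2 D ^ 2 ≤ t0 D ^ 2 := by
        have e3 : ell D ^ 10 * ell2 D ^ 2 = ell D ^ 810 := by rw [hℓ2]; ring
        have e4 : t0 D ^ 2 = ell D ^ 1038 := by rw [ht0]; ring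
        rw [e3, e4]
        exact pow_le_pow_right₀ hℓ1 (by norm_num)
      have h3 : 9 * (x - t0 D) ^ 2 ≤ π ^ 2 * (x - t0 D) ^ 2 :=
        mul_le_mul_of_nonneg_right hπ2 (sq_nonneg _)
      have e2 : (π * (x - t0 D) / ell2 D) ^ 2 = π ^ 2 * (x - t0 D) ^ 2 / ell2 D ^ 2 := by ring
      rw [e2, le_div_iff₀ (pow_pos hℓ2pos 2)]
      nlinarith [sq_nonneg (t0 D)]
    exact mul_le_mul hsq hgauss (Real.exp_pos _).le (by norm_num)
  have hlogP : Real.log (bigP D) = ell D ^ 9 := by rw [bigP, Real.log_exp]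
  have hαeq : alpha D = π / ell D ^ 9 := by rw [alpha, hlogP]
  have hα : alpha D ≤ π := by
    rw [hαeq]; exact div_le_self Real.pi_pos.le (one_le_pow₀ hℓ1)
  have hα0 : 0 ≤ alpha D := by
    rw [hαeq]; exact div_nonneg Real.pi_pos.le (pow_nonneg hℓ0.le 9)
  have hωn : 0 ≤ ‖omegaW D (1 / 2 + 2 * π * x * I)‖ := norm_nonneg _
  have hCα : C * alpha D * ‖omegaW D (1 / 2 + 2 * π * x * I)‖ ≤
      C₀ * π * ‖omegaW D (1 / 2 + 2 * π * x * I)‖ := by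
    apply mul_le_mul_of_nonneg_right _ hωn
    calc C * alpha D ≤ C₀ * alpha D := mul_le_mul_of_nonneg_right hCC₀ hα0
      _ ≤ C₀ * π := mul_le_mul_of_nonneg_left hα hC₀0
  have hA := mul_le_mul_of_nonneg_left hω (by positivity : (0:ℝ) ≤ C₀ * π + 1)
  have hB := mul_le_mul_of_nonneg_left hexp1 (by positivity : (0:ℝ) ≤ 2 * (C₀ * π + 1))
  calc ‖DeltaW D x‖
      ≤ ‖DeltaW D x - omegaW D (1 / 2 + 2 * π * x * I)‖ +
          ‖omegaW D (1 / 2 + 2 * π * x * I)‖ := norm_le_norm_sub_add _ _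
    _ ≤ C * alpha D * ‖omegaW D (1 / 2 + 2 * π * x * I)‖ + Real.exp (-c * ell D ^ 10) +
          ‖omegaW D (1 / 2 + 2 * π * x * I)‖ := by linarith
    _ ≤ C₀ * π * ‖omegaW D (1 / 2 + 2 * π * x * I)‖ + Real.exp (-c₁ * ell D ^ 10) +
          ‖omegaW D (1 / 2 + 2 * π * x * I)‖ := by linarith
    _ = (C₀ * π + 1) * ‖omegaW D (1 / 2 + 2 * π * x * I)‖ + Real.exp (-c₁ * ell D ^ 10) := by
          ring
    _ ≤ (C₀ * π + 1) * (2 * Real.exp (-ell D ^ 10)) + Real.exp (-c₁ * ell D ^ 10) := by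
          linarith
    _ ≤ (C₀ * π + 1) * (2 * Real.exp (-c₁ * ell D ^ 10)) + Real.exp (-c₁ * ell D ^ 10) := by
          linarith
    _ = (2 * C₀ * π + 3) * Real.exp (-c₁ * ell D ^ 10) := by ring

end Params

set_option maxHeartbeats 400000 in
/-- **`Δ` away from `t₀`**: there is an absolute `c > 0` such that for all large `D` and every
`x > 0` with `|x − t₀| ≥ (3/5)t₀`, `‖Δ(x)‖ ≤ e^{−c𝓛¹⁰}·x⁻⁶` — from Lemma 5.3 (tree
`Skeleton.lemma53_holds`): on `x ≤ t₀^{1.02}` by (5.8) and the Gaussian profile of `ω` (exponent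
`(π(x−t₀)/𝓛₂)² ≥ 𝓛²³⁸`), on `x > t₀^{1.02}` by (5.9) (`(10⁻²𝓛₂log x)² ≥ 6log x + 𝓛¹⁰`,
`x^{0.99}/(2𝓛₂) ≥ 𝓛¹⁰`, `e^{−y} ≤ 7!2⁷y⁻⁷e^{−y/2}`). [cite: Zhang2022LandauSiegel, §5 Lemma 5.3 (5.8)–(5.9)] -/
theorem norm_DeltaW_le_of_far :
    ∃ c : ℝ, 0 < c ∧ ForAllLarge fun D _ _ => ∀ x : ℝ, 0 < x → 3 / 5 * t0 D ≤ |x - t0 D| →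
      ‖DeltaW D x‖ ≤ Real.exp (-c * ell D ^ 10) * (x ^ 6)⁻¹ := by
  obtain ⟨c, hc, C, D₁, h53⟩ := lemma53_holds
  set c₁ : ℝ := min c 1 with hc₁
  have hc₁pos : 0 < c₁ := lt_min hc one_pos
  have hc₁1 : c₁ ≤ 1 := min_le_right _ _
  set C₀ : ℝ := max C 0 with hC₀
  have hC₀0 : 0 ≤ C₀ := le_max_right _ _
  have hCC₀ : C ≤ C₀ := le_max_left _ _
  set K : ℝ := 2 * C₀ * π + 3 + 645121 * C₀ with hK
  have hK0 : 0 < K := by positivity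
  -- eventually in `𝓛`: `K𝓛⁹⁰²⁸ ≤ exp((c₁/2)𝓛)` and `10⁴ ≤ 𝓛`
  have hev : ∃ D₂ : ℕ, ∀ D : ℕ, D₂ ≤ D →
      K * ell D ^ 9028 ≤ Real.exp (c₁ / 2 * ell D) ∧ (10000 : ℝ) ≤ ell D := by
    have h1 : ∀ᶠ L : ℝ in atTop, ‖L ^ 9028‖ ≤ K⁻¹ * ‖Real.exp (c₁ / 2 * L)‖ :=
      (isLittleO_pow_exp_pos_mul_atTop 9028 (by positivity : (0:ℝ) < c₁ / 2)).bound
        (by positivity)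
    have h2 : ∀ᶠ L : ℝ in atTop, (10000 : ℝ) ≤ L := eventually_ge_atTop _
    obtain ⟨D₂, h⟩ := eventually_ell (h1.and h2)
    refine ⟨D₂, fun D hD => ⟨?_, (h D hD).2⟩⟩
    obtain ⟨h1', h2'⟩ := h D hD
    rw [Real.norm_of_nonneg (pow_nonneg (by linarith) _),
      Real.norm_of_nonneg (Real.exp_pos _).le] at h1'
    calc K * ell D ^ 9028 ≤ K * (K⁻¹ * Real.exp (c₁ / 2 * ell D)) :=
          mul_le_mul_of_nonneg_left h1' hK0.le
      _ = Real.exp (c₁ / 2 * ell D) := by field_simp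
  obtain ⟨D₂, hev⟩ := hev
  refine ⟨c₁ / 2, by positivity, max D₁ D₂, fun D _ χ hD hq hp x hx hfar => ?_⟩
  obtain ⟨hKexp, hℓ⟩ := hev D (le_trans (le_max_right _ _) hD)
  have h53D := h53 D χ (le_trans (le_max_left _ _) hD) hq hp x hx
  obtain ⟨hℓ1, hℓ0, ht01, ht0pos, hℓ21, hℓ2pos, ht0, hℓ2⟩ := ell_facts hℓ
  set X₀ : ℝ := t0 D ^ (1.02 : ℝ) with hX₀
  have hX₀t : t0 D ≤ X₀ := by
    rw [hX₀]; exact Real.self_le_rpow_of_one_le ht01 (by norm_num)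
  have hX₀1 : 1 ≤ X₀ := ht01.trans hX₀t
  have hX₀pos : 0 < X₀ := by linarith
  have hX₀le : X₀ ≤ ell D ^ 1038 := by
    calc X₀ ≤ t0 D ^ (2 : ℝ) := by
          rw [hX₀]; exact Real.rpow_le_rpow_of_exponent_le ht01 (by norm_num)
      _ = ell D ^ 1038 := by rw [Real.rpow_two, ht0, ← pow_mul]
  have hX₀6 : X₀ ^ 6 ≤ ell D ^ 9028 := by
    calc X₀ ^ 6 ≤ (ell D ^ 1038) ^ 6 := pow_le_pow_left₀ hX₀pos.le hX₀le 6
      _ = ell D ^ 6228 := by rw [← pow_mul]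
      _ ≤ ell D ^ 9028 := pow_le_pow_right₀ hℓ1 (by norm_num)
  have hℓ27 : ell2 D ^ 7 ≤ ell D ^ 9028 := by
    rw [hℓ2, ← pow_mul]; exact pow_le_pow_right₀ hℓ1 (by norm_num)
  have hexp1 : Real.exp (-ell D ^ 10) ≤ Real.exp (-c₁ * ell D ^ 10) := by
    apply Real.exp_le_exp.mpr
    have : 0 ≤ ell D ^ 10 := pow_nonneg hℓ0.le 10
    nlinarith
  have hx6 : 0 < x ^ 6 := by positivity
  -- `‖Δ x‖ ≤ K 𝓛⁹⁰²⁸ e^{−c₁𝓛¹⁰} x⁻⁶`, in the two ranges of Lemma 5.3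
  have hmain : ‖DeltaW D x‖ ≤ K * ell D ^ 9028 * Real.exp (-c₁ * ell D ^ 10) * (x ^ 6)⁻¹ := by
    rcases le_or_gt x X₀ with hxX | hXx
    · have step1 := near_range hℓ hfar (h53D.1 hxX)
      have hrat : 1 ≤ X₀ ^ 6 * (x ^ 6)⁻¹ := by
        rw [← div_eq_mul_inv, one_le_div hx6]
        exact pow_le_pow_left₀ hx.le hxX 6
      have h1 : 2 * C₀ * π + 3 ≤ K := by rw [hK]; nlinarith
      have h2 : (2 * C₀ * π + 3) * Real.exp (-c₁ * ell D ^ 10) ≤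
          (2 * C₀ * π + 3) * Real.exp (-c₁ * ell D ^ 10) * (X₀ ^ 6 * (x ^ 6)⁻¹) :=
        le_mul_of_one_le_right (by positivity) hrat
      have h4 : K * Real.exp (-c₁ * ell D ^ 10) * (ell D ^ 9028 * (x ^ 6)⁻¹) =
          K * ell D ^ 9028 * Real.exp (-c₁ * ell D ^ 10) * (x ^ 6)⁻¹ := by ring
      have h3 : (2 * C₀ * π + 3) * Real.exp (-c₁ * ell D ^ 10) * (X₀ ^ 6 * (x ^ 6)⁻¹) ≤
          K * Real.exp (-c₁ * ell D ^ 10) * (ell D ^ 9028 * (x ^ 6)⁻¹) :=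
        mul_le_mul (mul_le_mul_of_nonneg_right h1 (Real.exp_pos _).le)
          (mul_le_mul_of_nonneg_right hX₀6 (inv_nonneg.mpr hx6.le))
          (mul_nonneg (pow_nonneg hX₀pos.le 6) (inv_nonneg.mpr hx6.le))
          (mul_nonneg hK0.le (Real.exp_pos _).le)
      exact step1.trans (h2.trans (h3.trans_eq h4))
    · have h59 := h53D.2 hXx
      have hx1 : 1 < x := lt_of_le_of_lt hX₀1 hXx
      have hxℓ : ell D ≤ x := by
        have : ell D ≤ t0 D := by rw [ht0]; exact le_self_pow₀ hℓ1 (by norm_num)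
        linarith
      have hu1 : 1 ≤ Real.log x := by
        rw [Real.le_log_iff_exp_le (by linarith)]
        have := Real.exp_one_lt_d9
        linarith
      have hbig : ell D ^ 10 * 2 * ell2 D ≤ x ^ (0.99 : ℝ) := by
        have hX099 : t0 D ≤ X₀ ^ (0.99 : ℝ) := by
          rw [hX₀, ← Real.rpow_mul ht0pos.le]
          exact Real.self_le_rpow_of_one_le ht01 (by norm_num)
        have hxX099 : X₀ ^ (0.99 : ℝ) ≤ x ^ (0.99 : ℝ) :=
          Real.rpow_le_rpow hX₀pos.le hXx.le (by norm_num)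
        have h410 : ell D ^ 10 * 2 * ell2 D ≤ t0 D := by
          rw [hℓ2, ht0]
          calc ell D ^ 10 * 2 * ell D ^ 400 = 2 * ell D ^ 410 := by ring
            _ ≤ ell D ^ 109 * ell D ^ 410 := by
                apply mul_le_mul_of_nonneg_right _ (pow_nonneg hℓ0.le 410)
                calc (2 : ℝ) ≤ ell D := by linarith
                  _ ≤ ell D ^ 109 := le_self_pow₀ hℓ1 (by norm_num)
            _ = ell D ^ 519 := by rw [← pow_add]
        linarith
      have hE1 := exp_logsq_le hℓ hx hu1
      have hE2 := exp_rpow_le hℓ hx1.le hbig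
      have hsum_pos : 0 < Real.exp (-((1 : ℝ) / 100 * ell2 D * Real.log x) ^ 2) +
          Real.exp (-(x ^ (0.99 : ℝ)) / ell2 D) := add_pos (Real.exp_pos _) (Real.exp_pos _)
      have h1 : C₀ * 645121 ≤ K := by rw [hK]; nlinarith [Real.pi_pos]
      have h7 : (1 : ℝ) ≤ ell2 D ^ 7 := one_le_pow₀ hℓ21
      have hExinv : 0 < Real.exp (-ell D ^ 10) * (x ^ 6)⁻¹ :=
        mul_pos (Real.exp_pos _) (inv_pos.mpr hx6)
      calc ‖DeltaW D x‖
          ≤ C * (Real.exp (-((1 : ℝ) / 100 * ell2 D * Real.log x) ^ 2) +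
              Real.exp (-(x ^ (0.99 : ℝ)) / ell2 D)) := h59
        _ ≤ C₀ * (Real.exp (-((1 : ℝ) / 100 * ell2 D * Real.log x) ^ 2) +
              Real.exp (-(x ^ (0.99 : ℝ)) / ell2 D)) :=
            mul_le_mul_of_nonneg_right hCC₀ hsum_pos.le
        _ ≤ C₀ * (Real.exp (-ell D ^ 10) * (x ^ 6)⁻¹ +
              645120 * ell2 D ^ 7 * (x ^ 6)⁻¹ * Real.exp (-ell D ^ 10)) :=
            mul_le_mul_of_nonneg_left (add_le_add hE1 hE2) hC₀0
        _ ≤ C₀ * (645121 * ell2 D ^ 7 * (x ^ 6)⁻¹ * Real.exp (-ell D ^ 10)) := by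
            apply mul_le_mul_of_nonneg_left _ hC₀0
            nlinarith
        _ = (C₀ * 645121) * ell2 D ^ 7 * Real.exp (-ell D ^ 10) * (x ^ 6)⁻¹ := by ring
        _ ≤ K * ell D ^ 9028 * Real.exp (-c₁ * ell D ^ 10) * (x ^ 6)⁻¹ := by
            apply mul_le_mul_of_nonneg_right _ (inv_nonneg.mpr hx6.le)
            exact mul_le_mul (mul_le_mul h1 hℓ27 (pow_nonneg hℓ2pos.le 7) hK0.le) hexp1
              (Real.exp_pos _).le (mul_nonneg hK0.le (pow_nonneg hℓ0.le _))
  -- absorb `K𝓛⁹⁰²⁸` into the exponential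
  have hfin : K * ell D ^ 9028 * Real.exp (-c₁ * ell D ^ 10) ≤
      Real.exp (-(c₁ / 2) * ell D ^ 10) := by
    have hℓ10 : ell D ≤ ell D ^ 10 := le_self_pow₀ hℓ1 (by norm_num)
    calc K * ell D ^ 9028 * Real.exp (-c₁ * ell D ^ 10)
        ≤ Real.exp (c₁ / 2 * ell D) * Real.exp (-c₁ * ell D ^ 10) :=
          mul_le_mul_of_nonneg_right hKexp (Real.exp_pos _).le
      _ = Real.exp (c₁ / 2 * ell D - c₁ * ell D ^ 10) := by rw [← Real.exp_add]; ring_nf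
      _ ≤ Real.exp (-(c₁ / 2) * ell D ^ 10) := Real.exp_le_exp.mpr (by nlinarith)
  calc ‖DeltaW D x‖ ≤ K * ell D ^ 9028 * Real.exp (-c₁ * ell D ^ 10) * (x ^ 6)⁻¹ := hmain
    _ ≤ Real.exp (-(c₁ / 2) * ell D ^ 10) * (x ^ 6)⁻¹ :=
        mul_le_mul_of_nonneg_right hfin (inv_nonneg.mpr hx6.le)

end Literature.NumberTheory.LFunctions.Zhang2022.DeltaFar
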